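import Mathlib
import HarnessLib
import Summits.AtomisticToContinuum.FouriersLaw.Theses.JunctionLocality
import Summits.AtomisticToContinuum.FouriersLaw.Theorems.JunctionLocalitySuperadditiveResistanceDeviceLiouville
import Summits.AtomisticToContinuum.FouriersLaw.Theorems.JunctionLocalitySuperadditiveResistanceKuboKernel
import Summits.AtomisticToContinuum.FouriersLaw.Theorems.JunctionLocalitySuperadditiveResistanceStubDeviceForwardFieldsAux5
import Summits.AtomisticToContinuum.FouriersLaw.Theorems.JunctionLocalityConductanceLowerBoundRelocDirichlet

/-!
# Relocated conductances are strictly positive (stub `stub_relocPositiveConductance`, R3, of line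
`cold-bath-relocation-walk`, crux stmt-AtomisticToContinuum-11749 `JunctionLocality.ConductanceLowerBound`)

Setting: ONE `L`-site pinned anharmonic chain `P = pinnedChain ω₂ lam β γ` (all parameters `> 0`), its Gibbs state
`μ_T = P.gibbsMeasure L T` (`T > 0`), and the RELOCATED equilibrium generator `L_m = X_H + γ (S_0 + S_m)` — hot
thermostat on site `0`, cold thermostat on site `m`, `1 ≤ m < L` (`X_H = liouvilleOp P L`,
`S_s = thermo L s T = T∂²_{p_s} − p_s∂_{p_s}`).  For every classical mean-zero `g ∈ C² ∩ L²(μ_T)` with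
`L_m g = −(p_0² − T)` pointwise, the relocated Kubo conductance
`G[g] = γ (1 − (γ/T²) ∫ g (p_0² − T) dμ_T)` is STRICTLY POSITIVE (`stub_relocPositiveConductance`) — the input the
relocation walk `1/G(m+1) − 1/G(m) ≤ C` of the line needs at every intermediate cold-bath position.

Proof (every input landed; nothing taken as a named fact):
* TRANSMISSION FORM (`relocTransmissionForm`, file `…RelocDirichlet`):
  `G[g] = (γ³/T)(‖p_0/γ − ∂_{p_0} g‖² + ‖∂_{p_m} g‖²) ≥ 0` (Dirichlet identity + Gaussian projection + equipartition).
* STRICTNESS: if `‖∂_{p_m} g‖_{L²(μ_T)} = 0` then `∂_{p_m} g ≡ 0` (`relocPositiveConductance_eq_zero_of_integral_sq`: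
  continuous integrand, continuous everywhere-positive density, Lebesgue measure charges open sets), hence
  `S_m g ≡ 0` and `g` solves the ONE-bath problem `X_H g + γ S_{𝟙_0} g = −(p_0² − T)`; so does `H/γ`
  (`Kubo.liouvilleOp_hamiltonian`: `X_H H = 0`; `Kubo.bathOp_hamiltonian`: `S_{𝟙_0} H = T − p_0²`; `H ∈ L²(μ_T)`,
  `Kubo.memLp_hamiltonian`).  The landed `L²(μ_T)`-Liouville theorem `liouville_pinnedChain` (weights `𝟙_0 ≥ 0`
  charging site `0`, `σ = 1`, `c = γ`) makes `g − H/γ` constant, so `∂_{p_m} g = p_m/γ`, which is `1/γ ≠ 0` at the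
  point with all momenta `1` — contradicting `∂_{p_m} g ≡ 0`.

References: Eckmann–Pillet–Rey-Bellet 1999 §3 (strict positivity of entropy production off the energy shell);
Rey-Bellet 2003 Rem. 4.4 (finite-volume Kubo conductance); Kundu–Dhar–Narayan 2009; folklore.
-/

noncomputable section

open MeasureTheory Filter Topology
open scoped ContDiff
open Literature.MathematicalPhysics.KineticTheory.HeatConduction
open Summit.AtomisticToContinuum.FouriersLaw.Theorems.SuperadditiveResistance.DeviceLiouville
  (kin kin_eq_sq thermo thermo_eq liouvilleOp bathOp liouvilleOp_sub bathOp_sub liouville_pinnedChain partialP_sub)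
open Summit.AtomisticToContinuum.FouriersLaw.Theorems.SuperadditiveResistance.Kubo
  (integrable_sq_mul_gibbsDensity liouvilleOp_hamiltonian bathOp_hamiltonian memLp_hamiltonian)
open Summit.AtomisticToContinuum.FouriersLaw.Cruxes.SuperadditiveResistance.FloatingProbeBypassLaplacian
  (liouvilleOp_const_mul bathOp_const_mul)
open Summit.AtomisticToContinuum.FouriersLaw.Cruxes.ConductanceLowerBound.ForecastSensitivity (sum_ite_val_eq)

namespace Summit.AtomisticToContinuum.FouriersLaw.Cruxes.ConductanceLowerBound.ColdBathRelocationWalk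

/-! ## The registered stub R3: relocated conductances are strictly positive -/

section Strictness

/-- The hot thermostat alone is the weighted bath operator of the single indicator `𝟙_0`:
`S_0 f = S_{𝟙_0} f`. [folklore] -/
theorem relocPositiveConductance_thermo_zero_eq_bathOp (L : ℕ) (T : ℝ) (f : PhaseSpace L → ℝ)
    (x : PhaseSpace L) :
    thermo L 0 T f x = bathOp L (fun i : Fin L => if i.val = 0 then (1 : ℝ) else 0) T f x := by
  unfold bathOp thermo
  refine Finset.sum_congr rfl fun i _ => ?_
  dsimp only
  split_ifs <;> ring

/-- A continuous function whose square has zero `μ_T`-integral vanishes identically (the Gibbs density is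
continuous and everywhere positive, Lebesgue measure charges open sets). [folklore] -/
theorem relocPositiveConductance_eq_zero_of_integral_sq {ω₂ lam β γ T : ℝ} (hω : 0 < ω₂) (hl : 0 ≤ lam)
    (hβ : 0 ≤ β) (hT : 0 < T) {L : ℕ} {F : PhaseSpace L → ℝ} (hFc : Continuous F)
    (hF2 : MemLp F 2 ((pinnedChain ω₂ lam β γ).gibbsMeasure L T))
    (hzero : ∫ x, F x ^ 2 ∂((pinnedChain ω₂ lam β γ).gibbsMeasure L T) = 0) (x : PhaseSpace L) :
    F x = 0 := by
  set P := pinnedChain ω₂ lam β γ with hP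
  haveI : IsProbabilityMeasure (P.gibbsMeasure L T) :=
    pinnedChain_isProbabilityMeasure_gibbsMeasure hω hl hβ γ L hT
  have hρc : Continuous (P.gibbsDensity L T) := pinnedChain_continuous_gibbsDensity ω₂ lam β γ L T
  have hρpos : ∀ y, 0 < P.gibbsDensity L T y := fun y => P.gibbsDensity_pos L T y
  have hI : Integrable fun y => F y ^ 2 * P.gibbsDensity L T y :=
    integrable_sq_mul_gibbsDensity hω hl hβ γ L hT hF2
  -- the normalising constant is nonzero (`μ_T` is a probability measure)
  have hZ : (∫ y, P.gibbsDensity L T y)⁻¹ ≠ 0 := by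
    intro h0
    have h1 : ∫ _y, (1 : ℝ) ∂(P.gibbsMeasure L T) = 1 := by simp
    rw [P.integral_gibbsMeasure, h0, zero_mul] at h1
    exact zero_ne_one h1
  have hZ' : ∫ y, F y ^ 2 * P.gibbsDensity L T y = 0 := by
    rw [P.integral_gibbsMeasure] at hzero
    exact (mul_eq_zero.mp hzero).resolve_left hZ
  have hae : (fun y => F y ^ 2 * P.gibbsDensity L T y) =ᵐ[volume] 0 :=
    (integral_eq_zero_iff_of_nonneg (fun y => mul_nonneg (sq_nonneg _) (hρpos y).le) hI).mp hZ'
  have hfun : (fun y => F y ^ 2 * P.gibbsDensity L T y) = 0 :=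
    (Continuous.ae_eq_iff_eq volume ((hFc.pow 2).mul hρc) continuous_const).mp hae
  have hx := congrFun hfun x
  simp only [Pi.zero_apply, mul_eq_zero, (hρpos x).ne', or_false] at hx
  exact pow_eq_zero_iff two_ne_zero |>.mp hx

/-- **R3 — RELOCATED CONDUCTANCES ARE POSITIVE (fixed `N`, size M).**  For `pinnedChain ω₂ lam β γ` (all parameters
`> 0`), `T > 0`, `1 ≤ m < L` and every classical mean-zero `C² ∩ L²(μ_T)` solution `g` of the relocated Poisson
problem `X_H g + γ(S_0 + S_m) g = −(p_0² − T)` (hot bath on site `0`, cold bath on site `m`), the relocated Kubo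
conductance `γ(1 − (γ/T²)⟨g, p_0² − T⟩_{μ_T})` is STRICTLY positive.  Proof: by the transmission form
(`relocTransmissionForm`) it equals `(γ³/T)(‖p_0/γ − ∂_{p_0} g‖² + ‖∂_{p_m} g‖²) ≥ 0`; if `‖∂_{p_m} g‖ = 0` then
`∂_{p_m} g ≡ 0` (continuity, positive density), so `S_m g ≡ 0` and `g` solves the ONE-bath problem
`X_H g + γ S_0 g = −(p_0² − T)`, as does `H/γ` (`X_H H = 0`, `S_0 H = T − p_0²`); the landed `L²(μ_T)`-Liouville theorem
(`liouville_pinnedChain`, weights `𝟙_0`) makes `g − H/γ` constant, whence `∂_{p_m} g = p_m/γ ≢ 0` — contradiction.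
[folklore] -/
theorem stub_relocPositiveConductance :
    ∀ (ω₂ lam β γ T : ℝ), 0 < ω₂ → 0 < lam → 0 < β → 0 < γ → 0 < T →
      ∀ (L m : ℕ), 1 ≤ m → m < L → ∀ g : PhaseSpace L → ℝ, ContDiff ℝ 2 g →
        MemLp g 2 ((pinnedChain ω₂ lam β γ).gibbsMeasure L T) →
        ∫ x, g x ∂((pinnedChain ω₂ lam β γ).gibbsMeasure L T) = 0 →
        (∀ x, liouvilleOp (pinnedChain ω₂ lam β γ) L g x + γ * (thermo L 0 T g x + thermo L m T g x) =
          -(kin L 0 x - T)) →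
        0 < γ * (1 - γ / T ^ 2 * ∫ x, g x * (kin L 0 x - T) ∂((pinnedChain ω₂ lam β γ).gibbsMeasure L T)) := by
  intro ω₂ lam β γ T hω hl hβ hγ hT L m hm1 hmL g hgC hgL2 _hg0 hpde
  have hL : 0 < L := lt_of_lt_of_le (Nat.lt_of_lt_of_le Nat.zero_lt_one hm1) hmL.le
  set P := pinnedChain ω₂ lam β γ with hP
  set μ := P.gibbsMeasure L T with hμ
  rw [relocTransmissionForm ω₂ lam β γ T hω hl hβ hγ hT L m hL hmL g hgC hgL2 hpde]
  have hY0 : 0 ≤ ∫ x, (x.2 ⟨0, hL⟩ / γ - partialP ⟨0, hL⟩ g x) ^ 2 ∂μ := integral_nonneg fun x => sq_nonneg _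
  have hYm : 0 ≤ ∫ x, (partialP ⟨m, hmL⟩ g x) ^ 2 ∂μ := integral_nonneg fun x => sq_nonneg _
  -- strictness: the cold-contact Dirichlet energy is nonzero
  suffices hne : ∫ x, (partialP ⟨m, hmL⟩ g x) ^ 2 ∂μ ≠ 0 by
    have hpos : 0 < ∫ x, (partialP ⟨m, hmL⟩ g x) ^ 2 ∂μ := lt_of_le_of_ne hYm (Ne.symm hne)
    positivity
  intro hzero
  -- (1) `∂_{p_m} g ≡ 0`
  obtain ⟨-, hamL2⟩ := relocMemLpPartialP ω₂ lam β γ T hω hl hβ hγ hT L m hL hmL g hgC hgL2 hpde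
  have hgd : Differentiable ℝ g := hgC.differentiable two_ne_zero
  have hg1 : ContDiff ℝ 1 g := hgC.of_le (by norm_cast)
  have hdc : Continuous (partialP ⟨m, hmL⟩ g) := continuous_partialP hg1 one_ne_zero _
  have hdm : ∀ x, partialP ⟨m, hmL⟩ g x = 0 :=
    relocPositiveConductance_eq_zero_of_integral_sq hω hl.le hβ.le hT hdc hamL2 hzero
  have hdm' : partialP ⟨m, hmL⟩ g = fun _ => 0 := funext hdm
  -- (2) hence `S_m g ≡ 0` and `g` solves the one-bath problem with weights `𝟙_0`
  have hthm : ∀ x, thermo L m T g x = 0 := fun x => by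
    rw [thermo_eq hmL, hdm']
    simp [partialP]
  set B1 : Fin L → ℝ := fun i => if i.val = 0 then (1 : ℝ) else 0 with hB1
  have hB1nn : ∀ i, 0 ≤ B1 i := fun i => by
    simp only [hB1]
    split_ifs <;> norm_num
  have hB10 : 0 < B1 ⟨0, hL⟩ := by simp [hB1]
  have hpg : ∀ x, 1 * liouvilleOp P L g x + γ * bathOp L B1 T g x = -(kin L 0 x - T) := fun x => by
    rw [one_mul, hB1, ← relocPositiveConductance_thermo_zero_eq_bathOp, ← hpde x, hthm x, add_zero]
  -- (3) `H/γ` solves the same one-bath problem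
  set H : PhaseSpace L → ℝ := P.hamiltonian L with hH
  have hH2 : ContDiff ℝ 2 H :=
    P.contDiff_hamiltonian (pinnedChain_contDiff_U ω₂ lam β γ) (pinnedChain_contDiff_V ω₂ lam β γ) L
  have hHd : Differentiable ℝ H := hH2.differentiable two_ne_zero
  have hHL2 : MemLp H 2 μ := memLp_hamiltonian hω hl.le hβ.le L hT
  have hsumB1 : ∀ x : PhaseSpace L, ∑ i, B1 i * (T - x.2 i ^ 2) = T - x.2 ⟨0, hL⟩ ^ 2 := fun x => by
    simp only [hB1, ite_mul, one_mul, zero_mul]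
    exact sum_ite_val_eq hL fun i => T - x.2 i ^ 2
  have hph : ∀ x, 1 * liouvilleOp P L (fun y => γ⁻¹ * H y) x + γ * bathOp L B1 T (fun y => γ⁻¹ * H y) x =
      -(kin L 0 x - T) := fun x => by
    rw [one_mul, liouvilleOp_const_mul P, bathOp_const_mul, hH, liouvilleOp_hamiltonian, bathOp_hamiltonian,
      hsumB1, kin_eq_sq hL]
    field_simp
    ring
  -- (4) the difference `w = g − H/γ` is a `C² ∩ L²(μ_T)` solution of the homogeneous one-bath equation: constant
  have hhd : Differentiable ℝ (fun y => γ⁻¹ * H y) := hHd.const_mul γ⁻¹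
  have hhC : ContDiff ℝ 2 (fun y => γ⁻¹ * H y) := contDiff_const.mul hH2
  have hwC : ContDiff ℝ 2 (fun y => g y - γ⁻¹ * H y) := hgC.sub hhC
  have hwL2 : MemLp (fun y => g y - γ⁻¹ * H y) 2 μ := hgL2.sub (hHL2.const_mul γ⁻¹)
  have hwpde : ∀ x, 1 * liouvilleOp P L (fun y => g y - γ⁻¹ * H y) x +
      γ * bathOp L B1 T (fun y => g y - γ⁻¹ * H y) x = 0 := fun x => by
    rw [liouvilleOp_sub hgd hhd, bathOp_sub hgC hhC]
    linear_combination hpg x - hph x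
  have hconst := liouville_pinnedChain hω hl.le hβ.le γ hL hT B1 hB1nn hB10 one_ne_zero hγ hwC hwL2 hwpde
  -- (5) but `∂_{p_m}(g − H/γ) = −p_m/γ ≢ 0`: evaluate at the point with all momenta `1`
  set x₁ : PhaseSpace L := (fun _ => (0 : ℝ), fun _ => (1 : ℝ)) with hx₁
  have hw_eq : (fun y => g y - γ⁻¹ * H y) = fun _ => g x₁ - γ⁻¹ * H x₁ := funext fun y => hconst y x₁
  have hdw : partialP ⟨m, hmL⟩ (fun y => g y - γ⁻¹ * H y) x₁ = 0 := by
    rw [hw_eq]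
    simp [partialP]
  rw [partialP_sub hgd hhd, hdm x₁, partialP_const_mul, hH, P.partialP_hamiltonian] at hdw
  have hγinv : γ⁻¹ = 0 := by simpa [hx₁] using hdw
  exact hγ.ne' (inv_eq_zero.mp hγinv)

end Strictness

end Summit.AtomisticToContinuum.FouriersLaw.Cruxes.ConductanceLowerBound.ColdBathRelocationWalk

end
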